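import Summits.ResolutionOfSingularities.ResolutionOfSingularities.Theses.RadicialJung
import Summits.ResolutionOfSingularities.ResolutionOfSingularities.Theorems.PAlterationPicoverOfDegP

/-!
# Crux `Picover` (stmt-ResolutionOfSingularities-0554) — route-level decomposition along the Jung condition

Route `ResolutionOfSingularities/pAlteration`, crux `Picover` (rank 2). Strategist split (crux-strategist,
2026-08-17): the crux is implied BY NAME by the two open items of the rescuer route `RadicialJung`,

* `RadicialJung.CleanModels` (stmt-ResolutionOfSingularities-15917, crux): every purely inseparable
  degree-`p` extension `L/K(W)` of a regular integral separated finite-type `W/k` (`char k = p`) admits a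
  proper birational REGULAR model `V → W` which is pointwise LOG-CLEAN for the class of `L` (Giraud's
  Jung condition for height-one radicial covers, reached by blowing up the regular BASE only — the
  embedded, base-side half; Giraud 1983 for `dim W = 2`, Cossart 1987 for `dim W = 3`, open from `4`);
* `RadicialJung.CleanResolves` (stmt-ResolutionOfSingularities-16286, support): a pointwise log-clean
  regular model resolves the normalisation of `W` in `L` (toroidal / Kato-log-regular endgame plus
  transport along `V^L → W^L`),

WITHOUT passing through the summit and without `Pialt`: the two pieces give the degree-`p` residue of the
crux (`W` regular, `[L : K(W)] = p` purely inseparable ⟹ `HasResolution (W^L)`) at once, and Temkin's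
degree-`p` tower (`Picover.OfDegP.picover_of_picoverDegP`, landed p91343) turns the residue into `Picover`.
This is the glue `Picover_of_subs` a tenure planner would cite for a route edit
`--split Picover --into CleanModels CleanResolves` on route `pAlteration` (NOT filed by the strategist:
`CleanResolves` carries a prover's `refuted-misstated` release note of 2026-08-16 — gluing clause
under-specified, rider form `CleanResolvesR` recommended — so the split should wait for RadicialJung's
restatement; the strategist's registered output is the alternative line `Lines/jung_clean_base.lean`,
which uses the RIDER form directly). Pure logic over the two item bodies (the relative normalisation in
`CleanResolves` is `normalizationIn W L` unfolded, definitionally). Planner-authored, hence a crux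
workfile and not a `Theorems/` file (Theorems is prover-only, D-0016); a prover may land it verbatim as
`Theorems/PAlterationPicoverSplit.lean --supports stmt-ResolutionOfSingularities-0554`.

Contrast with the lead's line `degree-p-tower` (skeleton `Cruxes/Picover/Lines/degree_p_tower.lean`), which
cuts the same residue by Temkin's noetherian localisation into printed dimension-`≤ 3` facts and a
punctual KERNEL at local dimension `≥ 4` (non-embedded germs): the present split is the EMBEDDED,
base-side alternative — all blow-ups happen on the regular `W`, where order / Hilbert–Samuel /
`E`-permissibility of the coherent differential-content ideal are defined, and the `p`-th-power
ambiguity `f ∼ f + c^p` that drives kangaroo / residual-order phenomena is invisible to `d(f)`.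
-/

noncomputable section

set_option linter.dupNamespace false -- mandated namespace of this single-conjunct summit

open CategoryTheory AlgebraicGeometry
open Literature.AlgebraicGeometry.Resolution
open Summit.ResolutionOfSingularities.ResolutionOfSingularities.Theses

namespace Summit.ResolutionOfSingularities.ResolutionOfSingularities.Cruxes.Picover.JungSplitGlue

/-- **Log-clean models and their toroidal resolution give the degree-`p` residue of `Picover`.**
For `W` regular integral separated of finite type over a field `k` of characteristic `p` and `L/K(W)`
purely inseparable of degree `p`: `CleanModels` supplies a proper birational regular `V → W`, pointwise
log-clean for the class of `L`; `CleanResolves` turns it into a resolution of the normalisation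
`W^L = normalizationIn W L` (its conclusion is that scheme, unfolded). [folklore] -/
theorem picoverDegP_of_cleanModels_cleanResolves (hC : RadicialJung.CleanModels)
    (hR : RadicialJung.CleanResolves) :
    ∀ (p : ℕ), p.Prime → ∀ (k : Type) [Field k] [CharP k p] (W : Scheme.{0}) [IsIntegral W]
      (f : W ⟶ Spec (.of k)) (L : Type) [Field L] [Algebra W.functionField L],
      IsSeparated f → LocallyOfFiniteType f → QuasiCompact f → Scheme.IsRegular W →
      IsPurelyInseparable W.functionField L → Module.finrank W.functionField L = p →
      Scheme.HasResolution (normalizationIn W L) := by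
  intro p hp k _ _ W _ f L _ _ hs hl hq hreg hpi hdeg
  obtain ⟨V, π, hV, hdom, hclean⟩ := hC p hp k W f L hs hl hq hreg hpi hdeg
  exact hR p hp k W f L hs hl hq hreg hpi hdeg V π hclean

/-- **Route-level decomposition of the crux `Picover` (glue `Picover_of_subs`)**: the Jung-condition
half `CleanModels` (log-clean regular models of the base exist) and the toroidal half `CleanResolves`
(a log-clean model resolves the normalisation) imply `Picover` BY NAME — the residue from the previous
theorem, then Temkin's degree-`p` tower `Picover.OfDegP.picover_of_picoverDegP`. Neither piece is the
crux reworded: `CleanModels` is a statement about blow-ups of the REGULAR base alone, `CleanResolves`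
is log / toric geometry under the clean hypothesis. [folklore] -/
theorem picover_of_cleanModels_cleanResolves :
    RadicialJung.CleanModels → RadicialJung.CleanResolves → PAlteration.Picover :=
  fun hC hR => Theorems.Picover.OfDegP.picover_of_picoverDegP (picoverDegP_of_cleanModels_cleanResolves hC hR)

/-- Alias under the split's conventional name (`<CruxDecl>_of_subs`). [folklore] -/
theorem Picover_of_subs :
    RadicialJung.CleanModels → RadicialJung.CleanResolves → PAlteration.Picover :=
  picover_of_cleanModels_cleanResolves

end Summit.ResolutionOfSingularities.ResolutionOfSingularities.Cruxes.Picover.JungSplitGlue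

end
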